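import Summits.CriticalPhenomena.PercolationContinuityZ3.Theorems.Transplant.SkelFrmBChoiceDefsT
import Summits.CriticalPhenomena.PercolationContinuityZ3.Theorems.Transplant.SkelFrmBChoiceKit
import Summits.CriticalPhenomena.PercolationContinuityZ3.Theorems.Transplant.SkelFrmBChoiceZone
import Summits.CriticalPhenomena.PercolationContinuityZ3.Theorems.Transplant.SkelFrmBChoiceLinks
import HarnessLib

/-!
# N2 (frames-only node `SamePDropOfSkeletonFrm₁`, OPEN), WAVE 1 under (R-40): THE `AtQNQ` UNPACKINGS AT THE T CHOICES OF RECORD `NegB.choiceAtQ3T` —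
# one-liner twins `…_of_atQT` of every cell-free `…_of_atQ` lemma of SkelFrmBChoiceAtQ (p350211) / SkelFrmBChoiceKit (p350987) / SkelFrmBChoiceZone
# (p351553 + p352693) / SkelFrmBChoiceLinks (p351172, p3-g16)

WHY ONE-LINERS: the premise `ChoiceNQ.AtQNQ 𝒞 O q` reads only `𝒞.m₀`, `𝒞.Sz`, `𝒞.SMn`, `𝒞.δI` (SkelFrm1ChoiceDefs :63), and these four fields of the T choices
`choiceAtQ3T` (SkelFrmBChoiceDefsT) and of the landed S choices `choiceAtQ3` (SkelFrmBChoiceDefs3) agree BY `rfl` — so `(choiceAtQ3T …).AtQNQ O q` and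
`(choiceAtQ3 …).AtQNQ O q` are the same proposition (`choiceAtQ3T_atQNQ_iff`, by unfolding the premise — NOT `Iff.rfl`, see the proof note), and every CELL-FREE consequence typed at `choiceAtQ3` (facts, clauses,
`EqNumL`, inputs at the served quadrant / at every centre / at the cube thresholds, zone rows, kit clause, kit-prism zone row, p3's K rows `hlong/hlongY`) holds at
`choiceAtQ3T` by the landed lemma applied to the converted premise.  This file gives them their `…T` NAMES (same statements, `choiceAtQ3 ↦ choiceAtQ3T` in the
premise only) so that the (R)/(F)/(C) skeleton files port by the lane's sed (`…_of_atQ ↦ …_of_atQT`, `…_of_atQ3 ↦ …_of_atQ3T`); nothing is re-proved.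
* §0 `choiceAtQ3T_atQNQ_iff`, `atQ3_of_atQ3T`;
* §1 (AtQ) `factsNS/shared/clauses/eqNumL/clauseL/clauseS/clauseP_of_atQT`, `sgQ_sel_eq_oneT`, `inputsP/inputsExtra/inputsS/inputsL_of_atQT`, `zone_of_atQT`,
  `inputsPAt/inputsExtraAt/inputsSAt/inputsLAt_of_atQT`, `zoneAt_of_atQT`;
* §2 (Kit) `clauseK/κK_int/ℓKit_ge/hΛRg_of_atQT`, `inputsLAt/inputsSAt/inputsPAt_cube_of_atQT`, `zoneAt_cube_of_atQT`;
* §3 (Zone) `hzconn/hkz/hcz/hczAt_of_atQT`; §4 (Links, p3-g16's K rows — twinned here as a courtesy so p3's `…QCT/…QDT` sed finds them) `zone_k_subset_zone_MuT`,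
  `hlong_of_atQ3T`, `hlongY_of_atQ3T`.
(`sgQ_eq_famSign_quad` has no `AtQNQ` premise — cell-free, NOT re-declared; use the landed one.)
NON-VACUITY (lead g11 standing order 03:52:56Z): inherited — each twin is the landed lemma at the same premise.
builds on p205010 (kernel theorem, internal audit signed; external expert review pending) — nothing in this file uses p205010; NOTHING is claimed about the open node
`SamePDropOfSkeletonFrm₁` (`SamePDropOfSkeletonNeg₁` is CLOSED in the tree and untouched by this file).
Lane `prim-bschramm`, seat `prim-bschramm-stmt` (gen 21); helper file (`--supports stmt-CriticalPhenomena-4575 --as helper`); rulings (R-31)/(R-33)/(R-35)/(R-40).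
[cite: KozmaNitzan2024, §4 Theorem 6 (pp. 25–31); pp. 19–21 ((21)–(25): the inputs at every vertex); p. 28 ((32))] [cite: MartineauTassion2017, §3.2 Lemma 3.5]
-/

noncomputable section

open scoped Classical

namespace Summit.CriticalPhenomena.PercolationContinuityZ3.Theorems.Transplant

open MeasureTheory Literature.Probability.Percolation Literature.Probability.LatticeModels SimpleGraph KNCells KNLevels
open Literature.Barriers.CriticalPhenomena (HasExponentialGrowth graphBall)

namespace PlanarSkeletonFrm

open SkelConc (Consts)
open BoxProdZ2 (ConcRadiiG)
open Skelφ (oriφ trφ)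
open Skelφ.StepI (DataN DataNS OutNS famSign)

namespace NegB

open Neg

section AtQ

variable {κ : Consts} {V : Type} [DecidableEq V] [Countable V] {G : SimpleGraph V} [G.LocallyFinite] {Φ : PlanarSkeletonFrm G} {t : V} {p : unitInterval}
  {hC : Φ.CylSubcritical p} {gv fv : Neg.FSlot} {Pv : PSlot} {Sv : SSlot} {cv : CSlot} {bv : BSlot} {O : OutNS V} {q : unitInterval} (mk : ℕ)

/-! ## §0 The premise is the same proposition -/

/-- **`AtQNQ` is the same premise for the T choices of record and the landed S choices** (it reads only `m₀`, `Sz`, `SMn`, `δI`, which agree by `rfl`). [folklore] -/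
theorem choiceAtQ3T_atQNQ_iff : (choiceAtQ3T κ Φ t p Pv gv fv Sv cv bv hC).AtQNQ O q ↔ (choiceAtQ3 κ Φ t p Pv gv fv Sv cv bv hC).AtQNQ O q := by
  -- NOT `Iff.rfl`: the unifier would first compare the two choice structures field by field (Γ: `cellGeomSG₂bT` vs `cellGeomSG₂bS`, whnf time-out); unfold the
  -- premise and rewrite the four fields it reads instead.
  simp only [ChoiceNQ.AtQNQ, choiceAtQ3T_δI, choiceAtQ3T_m₀, choiceAtQ3T_Sz, choiceAtQ3T_SMn, choiceAtQ3_δI]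

/-- `AtQNQ` of the T choices gives `AtQNQ` of the landed S choices (so every cell-free `…_of_atQ` lemma serves the T function). [folklore] -/
theorem atQ3_of_atQ3T (hAt : (choiceAtQ3T κ Φ t p Pv gv fv Sv cv bv hC).AtQNQ O q) : (choiceAtQ3 κ Φ t p Pv gv fv Sv cv bv hC).AtQNQ O q :=
  choiceAtQ3T_atQNQ_iff.1 hAt

/-- And conversely. [folklore] -/
theorem atQ3T_of_atQ3 (hAt : (choiceAtQ3 κ Φ t p Pv gv fv Sv cv bv hC).AtQNQ O q) : (choiceAtQ3T κ Φ t p Pv gv fv Sv cv bv hC).AtQNQ O q :=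
  choiceAtQ3T_atQNQ_iff.2 hAt

/-! ## §1–§4 The twins -/

/-- (R-40) T twin at `choiceAtQ3T` (one-liner over the S lemma `factsNS_of_atQ`): `FactsNS`, the density window and Φ2 at `q` out of `AtQNQ`. [folklore] -/
theorem factsNS_of_atQT (hAt : (choiceAtQ3T κ Φ t p Pv gv fv Sv cv bv hC).AtQNQ O q) :
    O.FactsNS (G := G) Φ.frame hC Neg.m₀ t ∧ (p : ℝ) / 2 ≤ q ∧ (q : ℝ) ≤ p ∧ Φ.CylSubcritical q :=
  factsNS_of_atQ (hAt := choiceAtQ3T_atQNQ_iff.1 hAt)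

/-- (R-40) T twin at `choiceAtQ3T` (one-liner over the S lemma `shared_of_atQ`): The shared fields of `DT` and `D` out of `AtQNQ`. [folklore] -/
theorem shared_of_atQT (hAt : (choiceAtQ3T κ Φ t p Pv gv fv Sv cv bv hC).AtQNQ O q) :
    O.DT.Λ = O.D.Λ ∧ O.DT.k = O.D.k ∧ O.DT.R = O.D.R ∧ O.DT.M₀ = O.D.M₀ ∧ O.DT.n₁ = O.D.n₁ :=
  shared_of_atQ (hAt := choiceAtQ3T_atQNQ_iff.1 hAt)

/-- (R-40) T twin at `choiceAtQ3T` (one-liner over the S lemma `clauses_of_atQ`): The oriented clauses at every admissible pair out of `AtQNQ`. [folklore] -/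
theorem clauses_of_atQT (hAt : (choiceAtQ3T κ Φ t p Pv gv fv Sv cv bv hC).AtQNQ O q) :
    ∀ M, O.D.M₀ ≤ M → ∀ n, O.D.n₁ M ≤ n →
      (O.ori t M n = true → O.D.EqGeom G Φ.φ t M n ∧ (O.D.hgt t M n).natAbs ≤ 10 * n) ∧
      (O.ori t M n = false → O.DT.EqGeom G (trφ Φ.φ) t M n ∧ (O.DT.hgt t M n).natAbs ≤ 10 * n) :=
  clauses_of_atQ (hAt := choiceAtQ3T_atQNQ_iff.1 hAt)

/-- (R-40) T twin at `choiceAtQ3T` (one-liner over the S lemma `eqNumL_of_atQ`): **The numeric long clause at the merged record** out of `AtQNQ`. [this work] -/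
theorem eqNumL_of_atQT (hAt : (choiceAtQ3T κ Φ t p Pv gv fv Sv cv bv hC).AtQNQ O q) :
    EqNumL κ Φ t p O.merged (gOf κ Φ t p O gv) (fOf κ Φ t p O fv) :=
  eqNumL_of_atQ (hAt := choiceAtQ3T_atQNQ_iff.1 hAt)

/-- (R-40) T twin at `choiceAtQ3T` (one-liner over the S lemma `clauseL_of_atQ`): **The long clause (oriented map `φL`, `|h_L| ≤ 10 n_L`)** out of `AtQNQ`. [this work] -/
theorem clauseL_of_atQT (hAt : (choiceAtQ3T κ Φ t p Pv gv fv Sv cv bv hC).AtQNQ O q) :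
    O.merged.EqGeom G (φL κ Φ t p O.D O.DT.toDataN O.ori (gOf κ Φ t p O gv) (fOf κ Φ t p O fv)) t (ML κ Φ t p O.merged (gOf κ Φ t p O gv))
        (nL κ Φ t p O.merged (gOf κ Φ t p O gv) (fOf κ Φ t p O fv)) ∧
      (hL κ Φ t p O.merged (gOf κ Φ t p O gv) (fOf κ Φ t p O fv)).natAbs ≤ 10 * nL κ Φ t p O.merged (gOf κ Φ t p O gv) (fOf κ Φ t p O fv) :=
  clauseL_of_atQ (hAt := choiceAtQ3T_atQNQ_iff.1 hAt)

/-- (R-40) T twin at `choiceAtQ3T` (one-liner over the S lemma `clauseS_of_atQ`): **The short clause (oriented map `φS`, `|h_s| ≤ 10 n_s`)** out of `AtQNQ`. [this work] -/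
theorem clauseS_of_atQT (hAt : (choiceAtQ3T κ Φ t p Pv gv fv Sv cv bv hC).AtQNQ O q) :
    O.merged.EqGeom G (φS t O.D O.DT.toDataN O.ori (Φ := Φ)) t (Mu O.merged) (nS O.merged) ∧ (hS t O.merged).natAbs ≤ 10 * nS O.merged :=
  clauseS_of_atQ (hAt := choiceAtQ3T_atQNQ_iff.1 hAt)

/-- (R-40) T twin at `choiceAtQ3T` (one-liner over the S lemma `clauseP_of_atQ`): **The clause of ANY admissible pair** (in particular every extra pair). [this work] -/
theorem clauseP_of_atQT (hAt : (choiceAtQ3T κ Φ t p Pv gv fv Sv cv bv hC).AtQNQ O q) {M n : ℕ} (hM : O.D.M₀ ≤ M) (hn : O.D.n₁ M ≤ n) :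
    O.merged.EqGeom G (oriφ Φ.φ (O.ori t M n)) t M n ∧ (O.merged.hgt t M n).natAbs ≤ 10 * n :=
  clauseP_of_atQ (hAt := choiceAtQ3T_atQNQ_iff.1 hAt) (hM := hM) (hn := hn)

/-- (R-40) T twin at `choiceAtQ3T` (one-liner over the S lemma `sgQ_sel_eq_one`): **At a SELECTED pair the served sign is `1`** (both families): `FactsNS`'s quadrant `(1, 1)`. [folklore] -/
theorem sgQ_sel_eq_oneT (hAt : (choiceAtQ3T κ Φ t p Pv gv fv Sv cv bv hC).AtQNQ O q) (M₁ N : ℕ) (fam : Fin 2) :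
    Skelφ.StepI.sgQ O.qd O.qdT O.ori t (O.D.sM M₁) (O.D.sN M₁ N) fam = 1 :=
  sgQ_sel_eq_one (hAt := choiceAtQ3T_atQNQ_iff.1 hAt) (M₁ := M₁) (N := N) (fam := fam)

/-- (R-40) T twin at `choiceAtQ3T` (one-liner over the S lemma `inputsP_of_atQ`): **THE PIECE-LINKS OF ANY LISTED PAIR at `q`, SERVED QUADRANT**: for `(M, n) ∈ SMnP`, family `fam`, far sign `τ`, the input at the oriented map over the merged
record with near sign `sgQ … t M n fam`, accuracy `δI3 = δkit³/16` ((R-33)). [this work] -/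
theorem inputsP_of_atQT (hAt : (choiceAtQ3T κ Φ t p Pv gv fv Sv cv bv hC).AtQNQ O q) {M n : ℕ}
    (hMn : (M, n) ∈ SMnP κ Φ t p O.merged (gOf κ Φ t p O gv) (fOf κ Φ t p O fv) Pv) (fam : Fin 2) (τ : ℤˣ) :
    1 - δI3 κ Φ < (bondPercolation G q).real
      (Skelφ.StepI.eventN G (oriφ Φ.φ (O.ori t M n)) O.merged.toDataN (t, M, some (n, fam, Skelφ.StepI.sgQ O.qd O.qdT O.ori t M n fam, τ))) :=
  inputsP_of_atQ (hAt := choiceAtQ3T_atQNQ_iff.1 hAt) (hMn := hMn) (fam := fam) (τ := τ)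

/-- (R-40) T twin at `choiceAtQ3T` (one-liner over the S lemma `inputsExtra_of_atQ`): **The extra pairs' piece-links** (served quadrant): for `(M, n) ∈ (Pv …).1`. [this work] -/
theorem inputsExtra_of_atQT (hAt : (choiceAtQ3T κ Φ t p Pv gv fv Sv cv bv hC).AtQNQ O q) {M n : ℕ} (hMn : (M, n) ∈ (Pv κ Φ t p O.merged).1) (fam : Fin 2) (τ : ℤˣ) :
    1 - δI3 κ Φ < (bondPercolation G q).real
      (Skelφ.StepI.eventN G (oriφ Φ.φ (O.ori t M n)) O.merged.toDataN (t, M, some (n, fam, Skelφ.StepI.sgQ O.qd O.qdT O.ori t M n fam, τ))) :=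
  inputsExtra_of_atQ (hAt := choiceAtQ3T_atQNQ_iff.1 hAt) (hMn := hMn) (fam := fam) (τ := τ)

/-- (R-40) T twin at `choiceAtQ3T` (one-liner over the S lemma `inputsS_of_atQ`): **The short pair's piece-links, near sign `1`** (`φS = oriφ Φ.φ (ori t M_u n_s)`; the short pair is the selected pair at `D.M₀`). [this work] -/
theorem inputsS_of_atQT (hAt : (choiceAtQ3T κ Φ t p Pv gv fv Sv cv bv hC).AtQNQ O q) (fam : Fin 2) (τ : ℤˣ) :
    1 - δI3 κ Φ < (bondPercolation G q).real
      (Skelφ.StepI.eventN G (φS t O.D O.DT.toDataN O.ori (Φ := Φ)) O.merged.toDataN (t, Mu O.merged, some (nS O.merged, fam, 1, τ))) :=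
  inputsS_of_atQ (hAt := choiceAtQ3T_atQNQ_iff.1 hAt) (fam := fam) (τ := τ)

/-- (R-40) T twin at `choiceAtQ3T` (one-liner over the S lemma `inputsL_of_atQ`): **The long pair's piece-links, near sign `1`** (`φL = oriφ Φ.φ (ori t M_L (n_L g f))`; the long pair is the selected pair at `max M_L g`). [this work] -/
theorem inputsL_of_atQT (hAt : (choiceAtQ3T κ Φ t p Pv gv fv Sv cv bv hC).AtQNQ O q) (fam : Fin 2) (τ : ℤˣ) :
    1 - δI3 κ Φ < (bondPercolation G q).real
      (Skelφ.StepI.eventN G (φL κ Φ t p O.D O.DT.toDataN O.ori (gOf κ Φ t p O gv) (fOf κ Φ t p O fv)) O.merged.toDataN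
        (t, ML κ Φ t p O.merged (gOf κ Φ t p O gv), some (nL κ Φ t p O.merged (gOf κ Φ t p O gv) (fOf κ Φ t p O fv), fam, 1, τ))) :=
  inputsL_of_atQ (hAt := choiceAtQ3T_atQNQ_iff.1 hAt) (fam := fam) (τ := τ)

/-- (R-40) T twin at `choiceAtQ3T` (one-liner over the S lemma `zone_of_atQ`): **The uniqueness zone at `M_u`** (as the merged record's zone input, any map). [this work] -/
theorem zone_of_atQT (hAt : (choiceAtQ3T κ Φ t p Pv gv fv Sv cv bv hC).AtQNQ O q) :
    1 - δI3 κ Φ < (bondPercolation G q).real (Skelφ.StepI.eventN G (φS t O.D O.DT.toDataN O.ori (Φ := Φ)) O.merged.toDataN (t, Mu O.merged, none)) :=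
  zone_of_atQ (hAt := choiceAtQ3T_atQNQ_iff.1 hAt)

/-- (R-40) T twin at `choiceAtQ3T` (one-liner over the S lemma `inputsPAt_of_atQ`): **THE PIECE-LINKS OF ANY LISTED PAIR AT EVERY CENTRE `c`, SERVED QUADRANT** (`ChoiceNQ.inputsAt_of_atQNQ` at `choiceAtQ3`). [cite: KozmaNitzan2024, §4 pp. 19–21] -/
theorem inputsPAt_of_atQT (hAt : (choiceAtQ3T κ Φ t p Pv gv fv Sv cv bv hC).AtQNQ O q) (h1 : Φ.types = {t}) (c : V) {M n : ℕ}
    (hMn : (M, n) ∈ SMnP κ Φ t p O.merged (gOf κ Φ t p O gv) (fOf κ Φ t p O fv) Pv) (fam : Fin 2) (τ : ℤˣ) :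
    1 - δI3 κ Φ < (bondPercolation G q).real
      (Skelφ.StepI.eventNAt G (oriφ Φ.φ (O.ori t M n)) O.merged.toDataN t c (M, some (n, fam, Skelφ.StepI.sgQ O.qd O.qdT O.ori t M n fam, τ))) :=
  inputsPAt_of_atQ (hAt := choiceAtQ3T_atQNQ_iff.1 hAt) (h1 := h1) (c := c) (hMn := hMn) (fam := fam) (τ := τ)

/-- (R-40) T twin at `choiceAtQ3T` (one-liner over the S lemma `inputsExtraAt_of_atQ`): **The extra pairs' piece-links at every centre** (served quadrant). [this work] -/
theorem inputsExtraAt_of_atQT (hAt : (choiceAtQ3T κ Φ t p Pv gv fv Sv cv bv hC).AtQNQ O q) (h1 : Φ.types = {t}) (c : V) {M n : ℕ} (hMn : (M, n) ∈ (Pv κ Φ t p O.merged).1)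
    (fam : Fin 2) (τ : ℤˣ) :
    1 - δI3 κ Φ < (bondPercolation G q).real
      (Skelφ.StepI.eventNAt G (oriφ Φ.φ (O.ori t M n)) O.merged.toDataN t c (M, some (n, fam, Skelφ.StepI.sgQ O.qd O.qdT O.ori t M n fam, τ))) :=
  inputsExtraAt_of_atQ (hAt := choiceAtQ3T_atQNQ_iff.1 hAt) (h1 := h1) (c := c) (hMn := hMn) (fam := fam) (τ := τ)

/-- (R-40) T twin at `choiceAtQ3T` (one-liner over the S lemma `inputsSAt_of_atQ`): **The short pair's piece-links at every centre, near sign `1`** (map `φS`). [cite: KozmaNitzan2024, §4 pp. 19–21] -/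
theorem inputsSAt_of_atQT (hAt : (choiceAtQ3T κ Φ t p Pv gv fv Sv cv bv hC).AtQNQ O q) (h1 : Φ.types = {t}) (c : V) (fam : Fin 2) (τ : ℤˣ) :
    1 - δI3 κ Φ < (bondPercolation G q).real
      (Skelφ.StepI.eventNAt G (φS t O.D O.DT.toDataN O.ori (Φ := Φ)) O.merged.toDataN t c (Mu O.merged, some (nS O.merged, fam, 1, τ))) :=
  inputsSAt_of_atQ (hAt := choiceAtQ3T_atQNQ_iff.1 hAt) (h1 := h1) (c := c) (fam := fam) (τ := τ)

/-- (R-40) T twin at `choiceAtQ3T` (one-liner over the S lemma `inputsLAt_of_atQ`): **The long pair's piece-links at every centre, near sign `1`** (map `φL`). [cite: KozmaNitzan2024, §4 pp. 19–21] -/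
theorem inputsLAt_of_atQT (hAt : (choiceAtQ3T κ Φ t p Pv gv fv Sv cv bv hC).AtQNQ O q) (h1 : Φ.types = {t}) (c : V) (fam : Fin 2) (τ : ℤˣ) :
    1 - δI3 κ Φ < (bondPercolation G q).real
      (Skelφ.StepI.eventNAt G (φL κ Φ t p O.D O.DT.toDataN O.ori (gOf κ Φ t p O gv) (fOf κ Φ t p O fv)) O.merged.toDataN t c
        (ML κ Φ t p O.merged (gOf κ Φ t p O gv), some (nL κ Φ t p O.merged (gOf κ Φ t p O gv) (fOf κ Φ t p O fv), fam, 1, τ))) :=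
  inputsLAt_of_atQ (hAt := choiceAtQ3T_atQNQ_iff.1 hAt) (h1 := h1) (c := c) (fam := fam) (τ := τ)

/-- (R-40) T twin at `choiceAtQ3T` (one-liner over the S lemma `zoneAt_of_atQ`): **The uniqueness zone at `M_u` AT EVERY CENTRE** (`UniqZone.zone G (O.merged.Λ c) O.merged.k M_u`; `UniqZone.zone` carries a `DecidableEq V` instance — the
generic junction states it classically, this corollary at the section's instance, bridged by `convert`). [this work] -/
theorem zoneAt_of_atQT (hAt : (choiceAtQ3T κ Φ t p Pv gv fv Sv cv bv hC).AtQNQ O q) (h1 : Φ.types = {t}) (c : V) :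
    1 - δI3 κ Φ < (bondPercolation G q).real (UniqZone.zone G (O.merged.Λ c) O.merged.k (Mu O.merged)) :=
  zoneAt_of_atQ (hAt := choiceAtQ3T_atQNQ_iff.1 hAt) (h1 := h1) (c := c)

/-- (R-40) T twin at `choiceAtQ3T` (one-liner over the S lemma `clauseK_of_atQ`): **The kit pair's clause (map `φK`, `|h_kit| ≤ 10 n_kit`)** out of `AtQNQ`, any kit index `mk`. [this work] -/
theorem clauseK_of_atQT (hAt : (choiceAtQ3T κ Φ t p Pv gv fv Sv cv bv hC).AtQNQ O q) :
    O.merged.EqGeom G (KS.φK Φ t O.D O.DT.toDataN O.ori mk) t (KS.MK O.merged mk) (KS.nKit O.merged mk) ∧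
      (KS.hKit t O.merged mk).natAbs ≤ 10 * KS.nKit O.merged mk :=
  clauseK_of_atQ (hAt := choiceAtQ3T_atQNQ_iff.1 hAt) (mk := mk)

/-- (R-40) T twin at `choiceAtQ3T` (one-liner over the S lemma `κK_int_of_atQ`): The ℤ form `|h_kit| ≤ 10·n_kit` (p1's `hκS`). [folklore] -/
theorem κK_int_of_atQT (hAt : (choiceAtQ3T κ Φ t p Pv gv fv Sv cv bv hC).AtQNQ O q) :
    |KS.hKit t O.merged mk| ≤ 10 * (KS.nKit O.merged mk : ℤ) :=
  κK_int_of_atQ (hAt := choiceAtQ3T_atQNQ_iff.1 hAt) (mk := mk)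

/-- (R-40) T twin at `choiceAtQ3T` (one-liner over the S lemma `ℓKit_ge_of_atQ`): `24·M_u + 64 ≤ ℓ_kit` out of `AtQNQ`. [folklore] -/
theorem ℓKit_ge_of_atQT (hAt : (choiceAtQ3T κ Φ t p Pv gv fv Sv cv bv hC).AtQNQ O q) :
    24 * Mu O.merged + 64 ≤ KS.ℓKit t O.merged mk :=
  ℓKit_ge_of_atQ (hAt := choiceAtQ3T_atQNQ_iff.1 hAt) (mk := mk)

/-- (R-40) T twin at `choiceAtQ3T` (one-liner over the S lemma `hΛRg_of_atQ`): **`hΛRg`**: at `AtQNQ`, for every kit index `mk` and every centre `c`, the zone `Λ c M_u` of the merged record lies in the kit pair's prism `KS.RgK … mk φK c`.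
[cite: KozmaNitzan2024, §4 p. 28 ((32): the zone inside the kit region)] -/
theorem hΛRg_of_atQT (hAt : (choiceAtQ3T κ Φ t p Pv gv fv Sv cv bv hC).AtQNQ O q) :
    ∀ c, O.merged.Λ c (Mu O.merged) ⊆ KS.RgK G t O.merged mk (KS.φK Φ t O.D O.DT.toDataN O.ori mk) c :=
  hΛRg_of_atQ (hAt := choiceAtQ3T_atQNQ_iff.1 hAt) (mk := mk)

/-- (R-40) T twin at `choiceAtQ3T` (one-liner over the S lemma `inputsLAt_cube_of_atQ`): **The long pair's piece-links at every centre at accuracy `1 − a³`** for any `a ≥ δkit` (e.g. `a := κ.δr 0` by `Neg.δkit_le_δr κ Φ (n := 0)`, `a := κ.δ₂` by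
`Neg.δkit_le_δ₂`) — the shape the (R)/(C)/(F) kit clauses' `hlong` binders consume. [cite: KozmaNitzan2024, §4 pp. 19–21] -/
theorem inputsLAt_cube_of_atQT (hAt : (choiceAtQ3T κ Φ t p Pv gv fv Sv cv bv hC).AtQNQ O q) (h1 : Φ.types = {t}) {a : ℝ} (ha : Neg.δkit κ Φ ≤ a) (c : V) (fam : Fin 2) (τ : ℤˣ) :
    1 - a ^ 3 < (bondPercolation G q).real
      (Skelφ.StepI.eventNAt G (φL κ Φ t p O.D O.DT.toDataN O.ori (gOf κ Φ t p O gv) (fOf κ Φ t p O fv)) O.merged.toDataN t c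
        (ML κ Φ t p O.merged (gOf κ Φ t p O gv), some (nL κ Φ t p O.merged (gOf κ Φ t p O gv) (fOf κ Φ t p O fv), fam, 1, τ))) :=
  inputsLAt_cube_of_atQ (hAt := choiceAtQ3T_atQNQ_iff.1 hAt) (h1 := h1) (ha := ha) (c := c) (fam := fam) (τ := τ)

/-- (R-40) T twin at `choiceAtQ3T` (one-liner over the S lemma `inputsSAt_cube_of_atQ`): **The short pair's piece-links at every centre at accuracy `1 − a³`** (`a ≥ δkit`). [cite: KozmaNitzan2024, §4 pp. 19–21] -/
theorem inputsSAt_cube_of_atQT (hAt : (choiceAtQ3T κ Φ t p Pv gv fv Sv cv bv hC).AtQNQ O q) (h1 : Φ.types = {t}) {a : ℝ} (ha : Neg.δkit κ Φ ≤ a) (c : V) (fam : Fin 2) (τ : ℤˣ) :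
    1 - a ^ 3 < (bondPercolation G q).real
      (Skelφ.StepI.eventNAt G (φS t O.D O.DT.toDataN O.ori (Φ := Φ)) O.merged.toDataN t c (Mu O.merged, some (nS O.merged, fam, 1, τ))) :=
  inputsSAt_cube_of_atQ (hAt := choiceAtQ3T_atQNQ_iff.1 hAt) (h1 := h1) (ha := ha) (c := c) (fam := fam) (τ := τ)

/-- (R-40) T twin at `choiceAtQ3T` (one-liner over the S lemma `inputsPAt_cube_of_atQ`): **Any listed pair's piece-links at every centre at accuracy `1 − a³`** (`a ≥ δkit`; served near sign; in particular the kit pair when `(MK, nKit) ∈ Pv`).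
[cite: KozmaNitzan2024, §4 pp. 19–21] -/
theorem inputsPAt_cube_of_atQT (hAt : (choiceAtQ3T κ Φ t p Pv gv fv Sv cv bv hC).AtQNQ O q) (h1 : Φ.types = {t}) {a : ℝ} (ha : Neg.δkit κ Φ ≤ a) (c : V) {M n : ℕ}
    (hMn : (M, n) ∈ SMnP κ Φ t p O.merged (gOf κ Φ t p O gv) (fOf κ Φ t p O fv) Pv) (fam : Fin 2) (τ : ℤˣ) :
    1 - a ^ 3 < (bondPercolation G q).real
      (Skelφ.StepI.eventNAt G (Skelφ.oriφ Φ.φ (O.ori t M n)) O.merged.toDataN t c (M, some (n, fam, Skelφ.StepI.sgQ O.qd O.qdT O.ori t M n fam, τ))) :=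
  inputsPAt_cube_of_atQ (hAt := choiceAtQ3T_atQNQ_iff.1 hAt) (h1 := h1) (ha := ha) (c := c) (hMn := hMn) (fam := fam) (τ := τ)

/-- (R-40) T twin at `choiceAtQ3T` (one-liner over the S lemma `zoneAt_cube_of_atQ`): **The zone at every centre at accuracy `1 − a³`** (`a ≥ δkit`). [this work] -/
theorem zoneAt_cube_of_atQT (hAt : (choiceAtQ3T κ Φ t p Pv gv fv Sv cv bv hC).AtQNQ O q) (h1 : Φ.types = {t}) {a : ℝ} (ha : Neg.δkit κ Φ ≤ a) (c : V) :
    1 - a ^ 3 < (bondPercolation G q).real (UniqZone.zone G (O.merged.Λ c) O.merged.k (Mu O.merged)) :=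
  zoneAt_cube_of_atQ (hAt := choiceAtQ3T_atQNQ_iff.1 hAt) (h1 := h1) (ha := ha) (c := c)

/-- (R-40) T twin at `choiceAtQ3T` (one-liner over the S lemma `hzconn_of_atQ`): **`hzconn`**: the `M_u`-zone is connected from its centre INSIDE ITSELF — `Λ c M_u = fatSeq c M_u = cylBall c M_u (fatRadius M_u)` and `pathIn_cylBall`. [folklore] -/
theorem hzconn_of_atQT (hAt : (choiceAtQ3T κ Φ t p Pv gv fv Sv cv bv hC).AtQNQ O q) :
    ∀ c, ∀ s ∈ O.merged.Λ c (Mu O.merged), PathIn G (↑(O.merged.Λ c (Mu O.merged)) : Set V) c s :=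
  hzconn_of_atQ (hAt := choiceAtQ3T_atQNQ_iff.1 hAt)

omit [DecidableEq V] in
/-- (R-40) T twin at `choiceAtQ3T` (one-liner over the S lemma `hkz_of_atQ`): **`hkz`** at `kz := M_u`: `1 ≤ M_u` (`1 ≤ k ≤ M₀ ≤ M_u`). [folklore] -/
theorem hkz_of_atQT [DecidableEq V] (hAt : (choiceAtQ3T κ Φ t p Pv gv fv Sv cv bv hC).AtQNQ O q) :
    1 ≤ Mu O.merged :=
  hkz_of_atQ (hAt := choiceAtQ3T_atQNQ_iff.1 hAt)

/-- (R-40) T twin at `choiceAtQ3T` (one-liner over the S lemma `hcz_of_atQ`): **`hcz`**: every centre lies in its own `M_u`-zone — `Λ c M_u = fatSeq c M_u ∋ c` (`self_mem_cylBall`); two-liner of p1-g17 (INBOX 2026-08-23T04:26:26Z,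
farm-checked there), landed here with the other zone rows. [folklore] -/
theorem hcz_of_atQT (hAt : (choiceAtQ3T κ Φ t p Pv gv fv Sv cv bv hC).AtQNQ O q) (c : V) :
    c ∈ O.merged.Λ c (Mu O.merged) :=
  hcz_of_atQ (hAt := choiceAtQ3T_atQNQ_iff.1 hAt) (c := c)

/-- (R-40) T twin at `choiceAtQ3T` (one-liner over the S lemma `hczAt_of_atQ`): **`hcz` at every level**: `c ∈ Λ c k` for all `k` (`Λ = fatSeq` at every level by `FactsO.seed`). [folklore] -/
theorem hczAt_of_atQT (hAt : (choiceAtQ3T κ Φ t p Pv gv fv Sv cv bv hC).AtQNQ O q) (c : V) (k : ℕ) :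
    c ∈ O.merged.Λ c k :=
  hczAt_of_atQ (hAt := choiceAtQ3T_atQNQ_iff.1 hAt) (c := c) (k := k)

/-- (R-40) T twin at `choiceAtQ3T` (one-liner over the S lemma `zone_k_subset_zone_Mu`): The zone at the seed level lies in the zone at `M_u` (nested fat seeds, `k ≤ M₀ ≤ M_u`). [folklore] -/
theorem zone_k_subset_zone_MuT (hAt : (choiceAtQ3T κ Φ t p Pv gv fv Sv cv bv hC).AtQNQ O q) (c : V) :
    O.merged.Λ c O.merged.k ⊆ O.merged.Λ c (Mu O.merged) :=
  zone_k_subset_zone_Mu (hAt := choiceAtQ3T_atQNQ_iff.1 hAt) (c := c)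

/-- (R-40) T twin at `choiceAtQ3T` (one-liner over the S lemma `hlong_of_atQ3`): **`hlong` AT EVERY CENTRE, LITERAL SHAPE**: the long pair's side-half links at accuracy `1 − a³` (`a ≥ δkit`), zone at `M_u`, served sign `σ = 1`.
[cite: KozmaNitzan2024, §4 pp. 19–21] -/
theorem hlong_of_atQ3T (hAt : (choiceAtQ3T κ Φ t p Pv gv fv Sv cv bv hC).AtQNQ O q) (h1 : Φ.types = {t}) {a : ℝ} (ha : Neg.δkit κ Φ ≤ a) :
    ∀ (c : V) (τ : ℤ), τ = 1 ∨ τ = -1 → 1 - a ^ 3 < (bondPercolation G q).real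
      (linkIn (Skelφ.pgramPrism G (φL κ Φ t p O.D O.DT.toDataN O.ori (gOf κ Φ t p O gv) (fOf κ Φ t p O fv)) c
          (nL κ Φ t p O.merged (gOf κ Φ t p O gv) (fOf κ Φ t p O fv)) (hL κ Φ t p O.merged (gOf κ Φ t p O gv) (fOf κ Φ t p O fv))
          (3 * ℓL κ Φ t p O.merged (gOf κ Φ t p O gv) (fOf κ Φ t p O fv)) (RL κ Φ t p O gv fv))
        (O.merged.Λ c (Mu O.merged))
        (Skelφ.pgSideHalfW G (φL κ Φ t p O.D O.DT.toDataN O.ori (gOf κ Φ t p O gv) (fOf κ Φ t p O fv)) c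
          (nL κ Φ t p O.merged (gOf κ Φ t p O gv) (fOf κ Φ t p O fv)) (hL κ Φ t p O.merged (gOf κ Φ t p O gv) (fOf κ Φ t p O fv))
          (ℓL κ Φ t p O.merged (gOf κ Φ t p O gv) (fOf κ Φ t p O fv)) (RL κ Φ t p O gv fv) 1 (1 * τ))) :=
  hlong_of_atQ3 (hAt := choiceAtQ3T_atQNQ_iff.1 hAt) (h1 := h1) (ha := ha)

/-- (R-40) T twin at `choiceAtQ3T` (one-liner over the S lemma `hlongY_of_atQ3`): **`hlongY` AT EVERY CENTRE, LITERAL SHAPE**: the long pair's top-piece links at accuracy `1 − a³`, zone at `M_u`, served sign `σ = 1`, split point `vL`.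
[cite: KozmaNitzan2024, §4 pp. 19–21] -/
theorem hlongY_of_atQ3T (hAt : (choiceAtQ3T κ Φ t p Pv gv fv Sv cv bv hC).AtQNQ O q) (h1 : Φ.types = {t}) {a : ℝ} (ha : Neg.δkit κ Φ ≤ a) :
    ∀ (c : V) (τ : ℤ), τ = 1 ∨ τ = -1 → 1 - a ^ 3 < (bondPercolation G q).real
      (linkIn (Skelφ.pgramPrism G (φL κ Φ t p O.D O.DT.toDataN O.ori (gOf κ Φ t p O gv) (fOf κ Φ t p O fv)) c
          (nL κ Φ t p O.merged (gOf κ Φ t p O gv) (fOf κ Φ t p O fv)) (hL κ Φ t p O.merged (gOf κ Φ t p O gv) (fOf κ Φ t p O fv))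
          (3 * ℓL κ Φ t p O.merged (gOf κ Φ t p O gv) (fOf κ Φ t p O fv)) (RL κ Φ t p O gv fv))
        (O.merged.Λ c (Mu O.merged))
        (Skelφ.pgTopPieceW G (φL κ Φ t p O.D O.DT.toDataN O.ori (gOf κ Φ t p O gv) (fOf κ Φ t p O fv)) c
          (nL κ Φ t p O.merged (gOf κ Φ t p O gv) (fOf κ Φ t p O fv)) (hL κ Φ t p O.merged (gOf κ Φ t p O gv) (fOf κ Φ t p O fv))
          (ℓL κ Φ t p O.merged (gOf κ Φ t p O gv) (fOf κ Φ t p O fv)) (RL κ Φ t p O gv fv) 1 τ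
          (vL κ Φ t p O.merged (gOf κ Φ t p O gv) (fOf κ Φ t p O fv)))) :=
  hlongY_of_atQ3 (hAt := choiceAtQ3T_atQNQ_iff.1 hAt) (h1 := h1) (ha := ha)

end AtQ

end NegB

end PlanarSkeletonFrm

end Summit.CriticalPhenomena.PercolationContinuityZ3.Theorems.Transplant

end
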